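import Literature.Geometry.Kaehler.RiemannSurfaceJacobianPolarization
import Literature.Geometry.Kaehler.ComplexTorusAbelianThreefoldPowersHodgeConjecture
import Literature.Geometry.Kaehler.ComplexTorusSimpleNonAlgebraicSubvarieties
import Literature.Geometry.Kaehler.ComplexTorusProductPowerIsomorphisms
import Literature.Geometry.Kaehler.ComplexTorusAbelianFourfoldThreeFactorsConditionD
import Literature.Geometry.Kaehler.ComplexTorusAbelianFivefoldSurfaceFactorsConditionD
import HarnessLib

/-!
# The Hodge conjecture for all powers of the Jacobian of a compact Riemann surface of genus `≤ 3`
# (Moonen–Zarhin, *Hodge classes on abelian varieties of low dimension*, Thm. (0.1); Lange §7.3)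

Layer `Literature/Geometry/Kaehler`, a bridge between the Riemann-surface development
(`RiemannSurfaceJacobianPolarization`: **`isAbelianVariety_jacobian`**, the Jacobian
`ℂ^g/Π ℤ^{2g} ≅ Jac(M)` of a compact connected Riemann surface is an abelian variety) and the lane's
theory of Hodge classes on complex tori (`ComplexTorusAbelianThreefoldPowersHodgeConjecture`: every
complex abelian variety `X` of dimension `1 ≤ dim X ≤ 3` satisfies condition (D) — the Hodge classes of
all powers `Xᵏ` are generated by divisor classes — and hence the Hodge `(p,p)`-conjecture in cycle form
for every torus isogenous to a power of `X`).

* **`forall_divisorClasses_powPeriod_periodMatrix_eq_hodgeClasses`**: for a compact connected Riemann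
  surface of genus `1 ≤ g ≤ 3`, `𝒟ᵖ(Jac(M)ᵏ) = ℬᵖ(Jac(M)ᵏ)` for all `k, p` (Hodge classes on all powers of
  the Jacobian are polynomials in divisor classes);
* **`analyticClasses_euclideanPresentation_periodMatrix_eq_hodgeClasses`**: the Hodge `(p,p)`-conjecture in
  cycle form, `Aᵖ = ℬᵖ`, for the Jacobian (in its Euclidean presentation, where analytic cycle classes live);
* `exists_jacobian_presentation_hodgeConjecture`: basis-free packaging;
* §2 **products**: for `M` of genus `2` and `N` of genus `1`, every power of `Jac(M)ᵃ × Jac(N)ᵇ` satisfies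
  condition (D) (`forall_divisorClasses_powPeriod_prod_jacobian_eq_hodgeClasses`, Moonen–Zarhin §5 (5.2) with
  §3 Cor. (3.9): abelian surface × elliptic curve; `Jac(N) ≅ E_τ`);
* §3 **three Jacobians**: genera `g₁ + g₂ + g₃ = 4` (all positive; Moonen–Zarhin Thm. (0.1) (4)) and genera
  `(2, 2, 1)` (Thm. (0.2) (4)): every power of `Jac(M₁) × Jac(M₂) × Jac(M₃)` satisfies condition (D).

Everything is proved; no named facts, no instances.

## References

* B. J. J. Moonen, Yu. G. Zarhin, *Hodge classes on abelian varieties of low dimension*, Math. Ann. 315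
  (1999) 711–733, Thm. (0.1) and §5 (5.2). [MoonenZarhin1999LowDim]
* H. Lange, *Abelian Varieties over the Complex Numbers*, Springer (2023), §4.1.2 Proposition 4.1.2 and
  §7.3.1. [Lange2023AbelianVarietiesComplex]
-/

noncomputable section

open scoped Manifold ContDiff Topology
open Set Function Complex Module
open Literature.Topology.CoveringSpaces

namespace Literature.Geometry.Kaehler

namespace RiemannSurface

open MeromorphicOneForm ComplexTorus

universe u

variable {M : Type u} [TopologicalSpace M] [ChartedSpace ℂ M] [ConnectedSpace M] [IsManifold 𝓘(ℂ, ℂ) ω M]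
  [IsManifold 𝓘(ℝ, ℂ) ∞ M] [CompactSpace M] [T2Space M] [Fact (Module.finrank ℝ ℂ = 2)]
  {σ : Type} [Fintype σ] [DecidableEq σ] (w : Module.Basis σ ℂ ↥(holomorphicOneForms M)) (x₀ : M)
  {κ : Type} [Fintype κ] [DecidableEq κ] (c : Module.Basis κ ℤ ↥(periods x₀))

omit [DecidableEq σ] [Fact (Module.finrank ℝ ℂ = 2)] in
/-- `dim_ℂ ℂ^σ = |σ|` (the dimension `g` of `ℂ^g = Ω(M)^*` in the coordinates of a basis).
[cite: Miranda1995, Chapter VIII §4 («a real basis for `ℂ^g`»)] -/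
theorem finrank_complex_pi_eq_card : finrank ℂ (σ → ℂ) = Fintype.card σ :=
  Module.finrank_fintype_fun_eq_card ℂ

/-- **Condition (D) for the Jacobian of a curve of genus `1 ≤ g ≤ 3`**: for every power `Jac(M)ᵏ` and
every `p`, the Hodge classes of degree `2p` are generated by divisor classes, `𝒟ᵖ(Jac(M)ᵏ) = ℬᵖ(Jac(M)ᵏ)`
(Moonen–Zarhin Thm. (0.1) applied to the abelian variety `Jac(M)`, `isAbelianVariety_jacobian`).
[cite: MoonenZarhin1999LowDim, Thm. (0.1) (4) and §5 (5.2)] [cite: Lange2023AbelianVarietiesComplex, §4.1.2 Proposition 4.1.2] -/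
theorem forall_divisorClasses_powPeriod_periodMatrix_eq_hodgeClasses (h0 : 0 < Fintype.card σ)
    (h3 : Fintype.card σ ≤ 3) :
    ∀ k p : ℕ, divisorClasses (powPeriod (periodMatrix x₀ w c) k) p = hodgeClasses (powPeriod (periodMatrix x₀ w c) k) p :=
  (isAbelianVariety_jacobian w x₀ c).forall_divisorClasses_powPeriod_eq_hodgeClasses_of_finrank_le_three
    (by rw [finrank_complex_pi_eq_card]; exact h0) (by rw [finrank_complex_pi_eq_card]; exact h3)

/-- The same in terms of the genus: `|σ| = g = arithGenus M`. [cite: MoonenZarhin1999LowDim, Thm. (0.1) (4)] -/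
theorem forall_divisorClasses_powPeriod_periodMatrix_eq_hodgeClasses_of_arithGenus_le_three
    (h0 : 0 < arithGenus M) (h3 : arithGenus M ≤ 3) :
    ∀ k p : ℕ, divisorClasses (powPeriod (periodMatrix x₀ w c) k) p = hodgeClasses (powPeriod (periodMatrix x₀ w c) k) p :=
  forall_divisorClasses_powPeriod_periodMatrix_eq_hodgeClasses w x₀ c (by rw [card_eq_arithGenus w]; exact h0)
    (by rw [card_eq_arithGenus w]; exact h3)

/-- **The Hodge `(p,p)`-conjecture in cycle form for the Jacobian of a curve of genus `1 ≤ g ≤ 3`**: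
in the Euclidean presentation `Ψ` of `Jac(M) = ℂ^g/Π ℤ^{2g}` (an isomorphic complex torus on an inner-product
space, where the fundamental classes of analytic cycles are defined), `Aᵖ(Ψ) = ℬᵖ(Ψ)` for every `p`.
[cite: MoonenZarhin1999LowDim, Introduction and §5 (5.2)] [cite: Lange2023AbelianVarietiesComplex, §7.3.1 (p. 336)] -/
theorem analyticClasses_euclideanPresentation_periodMatrix_eq_hodgeClasses (h0 : 0 < Fintype.card σ)
    (h3 : Fintype.card σ ≤ 3) (p : ℕ) :
    analyticClasses (euclideanPresentation (periodMatrix x₀ w c)) (Fintype.equivFin κ).symm p =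
      hodgeClasses (euclideanPresentation (periodMatrix x₀ w c)) p := by
  have hY : IsIsogenous (euclideanPresentation (periodMatrix x₀ w c)) (powPeriod (periodMatrix x₀ w c) 1) :=
    ((isIsomorphic_euclideanPresentation (periodMatrix x₀ w c)).symm.trans
      (isIsomorphic_powPeriod_one (periodMatrix x₀ w c))).isIsogenous
  exact hY.forall_analyticClasses_eq_hodgeClasses_of_powPeriod_of_finrank_le_three
    (euclideanPresentation (periodMatrix x₀ w c)) (Fintype.equivFin κ).symm (isAbelianVariety_jacobian w x₀ c)
    (by rw [finrank_complex_pi_eq_card]; exact h0) (by rw [finrank_complex_pi_eq_card]; exact h3) p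

/-- **Basis-free packaging**: the Jacobian of a compact connected Riemann surface of genus `1 ≤ g ≤ 3` is
presented by a period matrix `P : ℝ^{2g} ≃ ℂ^g` with `Jac(M) ≃+ ℂ^g/P ℤ^{2g}` an abelian variety all of
whose powers satisfy `𝒟ᵖ = ℬᵖ`. [cite: MoonenZarhin1999LowDim, Thm. (0.1) (4)] [cite: Lange2023AbelianVarietiesComplex, §4.1.2 Proposition 4.1.2] -/
theorem exists_jacobian_presentation_hodgeConjecture (h0 : 0 < arithGenus M) (h3 : arithGenus M ≤ 3) :
    ∃ P : (Fin (2 * arithGenus M) → ℝ) ≃L[ℝ] (Fin (arithGenus M) → ℂ),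
      Nonempty (Jacobian x₀ ≃+ ComplexTorus P) ∧ IsAbelianVariety P ∧
        ∀ k p : ℕ, divisorClasses (powPeriod P k) p = hodgeClasses (powPeriod P k) p := by
  classical
  haveI := moduleFree_int_periods x₀
  haveI := moduleFinite_int_periods x₀
  haveI : Module.Finite ℂ ↥(holomorphicOneForms M) := moduleFinite_holomorphicOneForms (M := M)
  let c' := Module.finBasisOfFinrankEq ℤ ↥(periods x₀) (finrank_int_periods x₀)
  let w' := Module.finBasisOfFinrankEq ℂ ↥(holomorphicOneForms M)
    (finrank_holomorphicOneForms_eq_arithGenus (M := M))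
  exact ⟨periodMatrix x₀ w' c', ⟨jacobianEquivComplexTorus x₀ w' c'⟩, isAbelianVariety_jacobian w' x₀ c',
    forall_divisorClasses_powPeriod_periodMatrix_eq_hodgeClasses_of_arithGenus_le_three w' x₀ c' h0 h3⟩

/-! ### §2 Products: a genus-`2` Jacobian times a genus-`1` Jacobian -/

section Products

variable {N : Type u} [TopologicalSpace N] [ChartedSpace ℂ N] [ConnectedSpace N] [IsManifold 𝓘(ℂ, ℂ) ω N]
  [CompactSpace N] [T2Space N]
  {σ' : Type} [Fintype σ'] [DecidableEq σ'] (w' : Module.Basis σ' ℂ ↥(holomorphicOneForms N)) (y₀ : N)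
  {κ' : Type} [Fintype κ'] [DecidableEq κ'] (c' : Module.Basis κ' ℤ ↥(periods y₀))

/-- **`Jac(M) × Jac(N)` satisfies condition (D) for `g(M) = 2`, `g(N) = 1`**: all powers of the product of
the Jacobian of a genus-`2` curve (an abelian surface) and of a genus-`1` curve (an elliptic curve
`≅ E_τ`) have only divisor-generated Hodge classes. [cite: MoonenZarhin1999LowDim, §5 (5.2) and §3 Cor. (3.9)] [cite: Lange2023AbelianVarietiesComplex, §4.1.2 Proposition 4.1.2] -/
theorem forall_divisorClasses_powPeriod_prod_jacobian_eq_hodgeClasses (h2 : Fintype.card σ = 2)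
    (h1 : Fintype.card σ' = 1) :
    ∀ k p : ℕ, divisorClasses (powPeriod (prodPeriod (periodMatrix x₀ w c) (periodMatrix y₀ w' c')) k) p =
      hodgeClasses (powPeriod (prodPeriod (periodMatrix x₀ w c) (periodMatrix y₀ w' c')) k) p := by
  haveI : Nonempty κ := Fintype.card_pos_iff.1 (by
    rw [card_basis_periods x₀ c, ← card_eq_arithGenus w, h2]; norm_num)
  obtain ⟨τ, hτ, hiso⟩ := exists_isIsomorphic_ellipticPeriod (periodMatrix y₀ w' c')
    (by rw [finrank_complex_pi_eq_card]; exact h1)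
  have hY : IsIsogenous (prodPeriod (periodMatrix x₀ w c) (periodMatrix y₀ w' c'))
      (prodPeriod (periodMatrix x₀ w c) (ellipticPeriod hτ)) :=
    (IsIsogenous.refl (periodMatrix x₀ w c)).prod hiso.isIsogenous
  exact hY.forall_powPeriod_divisorClasses_eq_hodgeClasses_iff.2
    ((isAbelianVariety_jacobian w x₀ c).forall_divisorClasses_powPeriod_prod_ellipticPeriod_eq_hodgeClasses_of_finrank_eq_two
      hτ (by rw [finrank_complex_pi_eq_card]; exact h2))

/-- **`Jac(M)ᵃ × Jac(N)ᵇ` satisfies condition (D) for `g(M) = 2`, `g(N) = 1`**, all `a, b ≥ 0`.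
[cite: MoonenZarhin1999LowDim, §5 (5.2) and §3 Cor. (3.9)] [cite: Lange2023AbelianVarietiesComplex, §7.3.3 Exercise (1)(b)] -/
theorem forall_divisorClasses_powPeriod_prod_pow_jacobian_eq_hodgeClasses [IsManifold 𝓘(ℝ, ℂ) ∞ N] (h2 : Fintype.card σ = 2)
    (h1 : Fintype.card σ' = 1) (a b : ℕ) :
    ∀ m p : ℕ,
      divisorClasses (powPeriod (prodPeriod (powPeriod (periodMatrix x₀ w c) a) (powPeriod (periodMatrix y₀ w' c') b)) m) p =
        hodgeClasses (powPeriod (prodPeriod (powPeriod (periodMatrix x₀ w c) a) (powPeriod (periodMatrix y₀ w' c') b)) m) p :=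
  (IsIsogenous.refl _).forall_powPeriod_divisorClasses_eq_hodgeClasses_of_prod_powPeriod
    (isAbelianVariety_jacobian w x₀ c) (isAbelianVariety_jacobian w' y₀ c')
    (forall_divisorClasses_powPeriod_prod_jacobian_eq_hodgeClasses w x₀ c w' y₀ c' h2 h1)

end Products

/-! ### §3 Three Jacobians: genera adding up to `4`, and genera `(2, 2, 1)` -/

section ThreeFactors

variable {N : Type u} [TopologicalSpace N] [ChartedSpace ℂ N] [ConnectedSpace N] [IsManifold 𝓘(ℂ, ℂ) ω N]
  [IsManifold 𝓘(ℝ, ℂ) ∞ N] [CompactSpace N] [T2Space N]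
  {σ' : Type} [Fintype σ'] [DecidableEq σ'] (w' : Module.Basis σ' ℂ ↥(holomorphicOneForms N)) (y₀ : N)
  {κ' : Type} [Fintype κ'] [DecidableEq κ'] (c' : Module.Basis κ' ℤ ↥(periods y₀))
  {P : Type u} [TopologicalSpace P] [ChartedSpace ℂ P] [ConnectedSpace P] [IsManifold 𝓘(ℂ, ℂ) ω P]
  [CompactSpace P] [T2Space P]
  {σ'' : Type} [Fintype σ''] [DecidableEq σ''] (w'' : Module.Basis σ'' ℂ ↥(holomorphicOneForms P)) (z₀ : P)
  {κ'' : Type} [Fintype κ''] [DecidableEq κ''] (c'' : Module.Basis κ'' ℤ ↥(periods z₀))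

/-- **`Jac(M) × Jac(N) × Jac(P)` satisfies condition (D) when the genera are positive and add up to `4`**
(genera `{2, 1, 1}` in some order: an abelian surface times two elliptic curves).
[cite: MoonenZarhin1999LowDim, Thm. (0.1) (4) and §5 (5.4)–(5.5)] [cite: Lange2023AbelianVarietiesComplex, §4.1.2 Proposition 4.1.2] -/
theorem forall_divisorClasses_powPeriod_prod_prod_jacobian_eq_hodgeClasses_of_card_add_eq_four
    [IsManifold 𝓘(ℝ, ℂ) ∞ P] (h₁ : 0 < Fintype.card σ) (h₂ : 0 < Fintype.card σ') (h₃ : 0 < Fintype.card σ'')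
    (h4 : Fintype.card σ + Fintype.card σ' + Fintype.card σ'' = 4) :
    ∀ k p : ℕ,
      divisorClasses (powPeriod (prodPeriod (prodPeriod (periodMatrix x₀ w c) (periodMatrix y₀ w' c')) (periodMatrix z₀ w'' c'')) k) p =
        hodgeClasses (powPeriod (prodPeriod (prodPeriod (periodMatrix x₀ w c) (periodMatrix y₀ w' c')) (periodMatrix z₀ w'' c'')) k) p :=
  (isAbelianVariety_jacobian w x₀ c).forall_divisorClasses_powPeriod_prod_prod_eq_hodgeClasses_of_finrank_add_eq_four
    (isAbelianVariety_jacobian w' y₀ c') (isAbelianVariety_jacobian w'' z₀ c'')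
    (by rw [finrank_complex_pi_eq_card]; exact h₁) (by rw [finrank_complex_pi_eq_card]; exact h₂)
    (by rw [finrank_complex_pi_eq_card]; exact h₃)
    (by rw [finrank_complex_pi_eq_card, finrank_complex_pi_eq_card, finrank_complex_pi_eq_card]; exact h4)

/-- **`Jac(M) × Jac(N) × Jac(P)` satisfies condition (D) for genera `(2, 2, 1)`** (two abelian surfaces times
an elliptic curve `≅ Jac(P)`). [cite: MoonenZarhin1999LowDim, Thm. (0.2) (4) and §5 (5.11)] [cite: Lange2023AbelianVarietiesComplex, §4.1.2 Proposition 4.1.2] -/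
theorem forall_divisorClasses_powPeriod_prod_prod_jacobian_eq_hodgeClasses_of_card_two_two_one
    (h₁ : Fintype.card σ = 2) (h₂ : Fintype.card σ' = 2) (h₃ : Fintype.card σ'' = 1) :
    ∀ k p : ℕ,
      divisorClasses (powPeriod (prodPeriod (prodPeriod (periodMatrix x₀ w c) (periodMatrix y₀ w' c')) (periodMatrix z₀ w'' c'')) k) p =
        hodgeClasses (powPeriod (prodPeriod (prodPeriod (periodMatrix x₀ w c) (periodMatrix y₀ w' c')) (periodMatrix z₀ w'' c'')) k) p := by
  obtain ⟨τ, hτ, hiso⟩ := exists_isIsomorphic_ellipticPeriod (periodMatrix z₀ w'' c'')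
    (by rw [finrank_complex_pi_eq_card]; exact h₃)
  have hY : IsIsogenous (prodPeriod (prodPeriod (periodMatrix x₀ w c) (periodMatrix y₀ w' c')) (periodMatrix z₀ w'' c''))
      (prodPeriod (prodPeriod (periodMatrix x₀ w c) (periodMatrix y₀ w' c')) (ellipticPeriod hτ)) :=
    (IsIsogenous.refl _).prod hiso.isIsogenous
  exact hY.forall_powPeriod_divisorClasses_eq_hodgeClasses_iff.2
    ((isAbelianVariety_jacobian w x₀ c).forall_divisorClasses_powPeriod_prod_prod_ellipticPeriod_eq_hodgeClasses_of_finrank_eq_two_two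
      hτ (isAbelianVariety_jacobian w' y₀ c') (by rw [finrank_complex_pi_eq_card]; exact h₁)
      (by rw [finrank_complex_pi_eq_card]; exact h₂))

end ThreeFactors

end RiemannSurface

end Literature.Geometry.Kaehler

end
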